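import Literature.NumberTheory.Rogawski1990.ArchLimitFormula                       -- ★ p840202 (B5): the LETTER's vocabulary (`circleDiagonal`, `descConj`, `quotientMeasure`, `forall_mem_centralizer_circleDiagonal_comm_of_wall`)
import Literature.NumberTheory.Automorphic.ArchLocalWallDescentCompact               -- ★ p840426 (d1): `exists_isCompact_forall_mk_mem_of_conj_mem_wall`
import Literature.NumberTheory.Automorphic.ArchTorusOrbitalFubiniSmooth              -- ★ p840553: `isCompact_setOf_coe_archLocal_mem` (properness of `G_w ↪ M₃(ℂ)`)
import Literature.Analysis.Calculus.ContDiffCompactSupportCutoff                     -- ★ p840156: `exists_contDiff_hasCompactSupport_eq_one_of_isCompact` (smooth bump)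
import Mathlib.NumberTheory.NumberField.CMField
import HarnessLib

/-!
# THE CONSTANT OF THE LETTER (J-nc) IS UNIQUE: two constants `c₁, c₂` satisfying the conclusion of `ArchLimitFormulaNoncompactWall L α w` at the same data `(ν, z₁, ν_H)` are EQUAL
# (ROAD-Sd (R1-d″)(a) «pinning»; Rogawski 1990 §8.2 p. 119, p. 123 L20–24)

Topic `NumberTheory/Rogawski1990`; namespaces `Literature.MeasureTheory.Group` (§1, generic) and `Literature.NumberTheory.Rogawski1990` (§2).  THEOREMS ONLY (no `def`, no instance, no
notation, no axiom, no named fact, no `sorry`).  Cell `pub/hodgecm-mathlib`, ENGINE T1 (crux H413 = `stmt-HodgeConjecture-24833`); ROAD-Sd (R1-d″)(a) «PINNING» (LEAD DESK WORD T8-77,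
F0P3a-plan (g9), 2026-09-01, on F0P3a-p07 (g7)'s (R1) machine); author F0P3a-p06 (g10).

THE POINT.  ★ p840819 `archLimitFormulaNoncompactWall_holds` (and its signed twin ★ p841317) produce the constant `c` by `∃`.  For the all-places induction (R1-e) one must COMPARE the
constants produced at different places ∕ relabellings; the first step is that at FIXED data `(ν, z₁, ν_H)` the constant is a well-defined number: the conclusion clause of the letter,
read with `c := c₁` and with `c := c₂`, forces `c₁ = c₂` (so `Classical.choose` of the letter names THE constant, and the `c ≠ 0` of ★ p840819 and the real `c < 0` of ★ p841317
are the same complex number).  PROOF: limits along `𝓝[≠] 0` are unique, so `c₁ · I(Θ, z₀) = c₂ · I(Θ, z₀)` for every admissible `(Θ, z₀)`; it remains to exhibit ONE pair with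
`I(Θ, z₀) = ∫_{G_w ⧸ H_w} descConj (t_w z₀) Θ d(ν∕ν_H) ≠ 0`: take `z₀ := z₁` and `Θ := χ`, a smooth bump on `Matrix (Fin 3) (Fin 3) ℂ` with `0 ≤ χ ≤ 1`, `χ(↑↑(t_w z₁)) = 1`
(★ p840156; `χ ∘ ↑↑` is compactly supported on `G_w` by the properness ★ `isCompact_setOf_coe_archLocal_mem`); then `descConj χ` is continuous, `≥ 0`, `= 1` at the base coset, and
COMPACTLY SUPPORTED on `G_w ⧸ H_w` (★ (d1) p840426 — this is where the CM structure enters), and the quotient measure charges every non-empty open set (§1), so `I > 0`.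
WHAT IS PROVED.  §1 `isOpenPosMeasure_quotientMeasure` — the invariant quotient measure `ν∕ρ` of ★ `InvariantQuotientExistence` is positive on non-empty open sets (Weil's formula ★
`integral_fiberIntegral_quotientMeasure` against a Urysohn function whose fibre integrals vanish off the open set).  §2 **`archLimitFormulaNoncompactWall_const_unique`**.
NOT HERE ((R1-d″)(b), (R1-d) value): invariance of the constant under weight relabelling ∕ coherent transport of `(ν, ν_H)`, and its VALUE against the compact-wall mass
[Rogawski1990 p. 123 L20–24] — open, named for the (R1-e) glue.
HONEST LABEL: HC_CM is proved only modulo the printed citations until rung 0 closes; this file pins a constant and pays nothing by itself.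

## References
* [Rogawski1990] J. D. Rogawski, *Automorphic Representations of Unitary Groups in Three Variables*, Ann. of Math. Stud. 123 (1990), §8.2 p. 119, p. 123.
* [DeitmarEchterhoff2014] A. Deitmar, S. Echterhoff, *Principles of Harmonic Analysis*, 2nd ed. (2014), Thm. 1.5.3 (the quotient integral formula).
-/

set_option autoImplicit false

noncomputable section

open MeasureTheory Measure Filter Topology NumberField NumberField.InfinitePlace Set
open Literature.MeasureTheory.Group Literature.NumberTheory.Automorphic Literature.NumberTheory.Automorphic.UnitaryGroup Literature.Analysis.Calculus
open scoped Matrix MatrixGroups Matrix.Norms.Operator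

/-! ## §1 Generic: the quotient measure charges non-empty open sets -/

namespace Literature.MeasureTheory.Group

/-- **The invariant quotient measure is positive on non-empty open sets.**  For `U ⊆ G ⧸ H` open with `gH ∈ U`: a Urysohn function `φ ∈ C_c(G)`, `0 ≤ φ ≤ 1`, `φ(g) = 1`,
`φ = 0` off `π⁻¹ U`, has fibre integrals vanishing off `U`; if `(ν∕ρ)(U) = 0` then `∫ φ^H d(ν∕ρ) = 0`, contradicting Weil's formula `∫ φ^H d(ν∕ρ) = ∫_G φ dν > 0`.
[cite: DeitmarEchterhoff2014, Thm. 1.5.3] -/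
theorem isOpenPosMeasure_quotientMeasure {G : Type*} [Group G] [TopologicalSpace G] [IsTopologicalGroup G] [LocallyCompactSpace G]
    [SecondCountableTopology G] [T2Space G] [MeasurableSpace G] [BorelSpace G]
    (H : Subgroup G) (hH : IsClosed (H : Set G)) (ρ : Measure H) [ρ.IsHaarMeasure] [ρ.IsInvInvariant]
    (ν : Measure G) [ν.IsHaarMeasure] [ν.IsMulRightInvariant]
    [MeasurableSpace (G ⧸ H)] [BorelSpace (G ⧸ H)] :
    (quotientMeasure H ρ hH ν).IsOpenPosMeasure := by
  haveI : IsClosed (H : Set G) := hH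
  refine ⟨fun U hU hne => ?_⟩
  obtain ⟨y, hy⟩ := hne
  obtain ⟨g, rfl⟩ := QuotientGroup.mk_surjective y
  have hV : IsOpen ((QuotientGroup.mk : G → G ⧸ H) ⁻¹' U) := hU.preimage QuotientGroup.continuous_mk
  obtain ⟨φ, hφ1, hφ0, hφs, hφ01⟩ :=
    exists_continuous_one_zero_of_isCompact (isCompact_singleton (x := g)) hV.isClosed_compl
      (disjoint_singleton_left.mpr (fun h => h hy))
  intro hU0
  -- the fibre integrals of `φ` vanish off `U`, hence `ν∕ρ`-a.e.
  have hfib0 : ∀ x, x ∉ U → fiberIntegral H ρ φ x = 0 := by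
    intro x hx
    obtain ⟨a, rfl⟩ := QuotientGroup.mk_surjective x
    rw [fiberIntegral_mk]
    refine integral_eq_zero_of_ae (Eventually.of_forall fun h => ?_)
    have hah : a * (h : G) ∉ (QuotientGroup.mk : G → G ⧸ H) ⁻¹' U := by
      simp only [Set.mem_preimage, QuotientGroup.mk_mul_of_mem a h.2]; exact hx
    exact hφ0 hah
  have hae : (fun x => fiberIntegral H ρ φ x) =ᵐ[quotientMeasure H ρ hH ν] 0 := by
    rw [EventuallyEq, ae_iff]
    refine measure_mono_null (fun x hx => ?_) hU0
    by_contra hxU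
    exact hx (hfib0 x hxU)
  have hW := integral_fiberIntegral_quotientMeasure H ρ hH ν ⟨φ, hφs⟩
  change ∫ x, fiberIntegral H ρ φ x ∂quotientMeasure H ρ hH ν = ∫ x, φ x ∂ν at hW
  rw [integral_congr_ae hae] at hW
  simp only [Pi.zero_apply, integral_zero] at hW
  -- but `∫_G φ dν > 0`
  have hpos : 0 < ∫ x, φ x ∂ν :=
    φ.continuous.integral_pos_of_hasCompactSupport_nonneg_nonzero hφs (fun x => (hφ01 x).1) (x := g)
      (by rw [hφ1 (Set.mem_singleton g)]; exact one_ne_zero)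
  exact hpos.ne' hW.symm

end Literature.MeasureTheory.Group

/-! ## §2 Uniqueness of the (J-nc) constant -/

namespace Literature.NumberTheory.Rogawski1990

variable (L : Type) [Field L] [NumberField L] [IsCMField L] (α : Fin 3 → L) (w : {w : InfinitePlace L // IsComplex w})

/-- **THE (J-nc) CONSTANT IS UNIQUE.**  At fixed data `(ν, z₁, ν_H)` of the letter ★ `ArchLimitFormulaNoncompactWall L α w`, two complex numbers `c₁, c₂` that both satisfy its conclusion
clause (for all smooth `Θ` compactly supported on `G_w` and all wall points `z₀`) are equal.  (`[NumberField L] [IsCMField L]` enter through ★ (d1) p840426, which makes `descConj χ`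
compactly supported on `G_w ⧸ H_w`; `c(α_i) = α_i` is derived from the letter's own `(σ_w α_i).im = 0`.) [cite: Rogawski1990, §8.2 p. 119; p. 123] -/
theorem archLimitFormulaNoncompactWall_const_unique
    [LocallyCompactSpace (archLocal L 3 (Matrix.diagonal α) w)] [SecondCountableTopology (archLocal L 3 (Matrix.diagonal α) w)]
    [MeasurableSpace (archLocal L 3 (Matrix.diagonal α) w)] [BorelSpace (archLocal L 3 (Matrix.diagonal α) w)]
    (hα : ∀ i, α i ≠ 0) (hreal : ∀ i, (w.1.embedding (α i)).im = 0)
    (ν : Measure (archLocal L 3 (Matrix.diagonal α) w)) [ν.IsHaarMeasure] [ν.IsMulRightInvariant]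
    {z₁ : Fin 3 → Circle} (h02 : z₁ 0 = z₁ 2) (h01 : z₁ 0 ≠ z₁ 1)
    (νH : Measure (Subgroup.centralizer ({(⟨circleDiagonal 3 z₁, circleDiagonal_mem_archLocal_diagonal L 3 α w z₁⟩ : archLocal L 3 (Matrix.diagonal α) w)} : Set (archLocal L 3 (Matrix.diagonal α) w)))) [νH.IsHaarMeasure] [νH.IsInvInvariant]
    [MeasurableSpace (archLocal L 3 (Matrix.diagonal α) w ⧸ Subgroup.centralizer ({(⟨circleDiagonal 3 z₁, circleDiagonal_mem_archLocal_diagonal L 3 α w z₁⟩ : archLocal L 3 (Matrix.diagonal α) w)} : Set (archLocal L 3 (Matrix.diagonal α) w)))]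
    [BorelSpace (archLocal L 3 (Matrix.diagonal α) w ⧸ Subgroup.centralizer ({(⟨circleDiagonal 3 z₁, circleDiagonal_mem_archLocal_diagonal L 3 α w z₁⟩ : archLocal L 3 (Matrix.diagonal α) w)} : Set (archLocal L 3 (Matrix.diagonal α) w)))]
    {c₁ c₂ : ℂ}
    (h₁ : ∀ (Θ : Matrix (Fin 3) (Fin 3) ℂ → ℂ), ContDiff ℝ (⊤ : ℕ∞) Θ →
        HasCompactSupport (fun k : archLocal L 3 (Matrix.diagonal α) w => Θ ((k : GL (Fin 3) ℂ) : Matrix (Fin 3) (Fin 3) ℂ)) →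
        ∀ (z₀ : Fin 3 → Circle) (h02' : z₀ 0 = z₀ 2) (h01' : z₀ 0 ≠ z₀ 1),
          Tendsto (fun ψ : ℝ => deriv (fun ψ : ℝ => (2 * Real.sin ψ : ℂ) *
              ∫ g, Θ (((g * ⟨circleDiagonal 3 (fun i => z₀ i * Circle.exp (![(1 : ℝ), 0, -1] i * ψ)),
                circleDiagonal_mem_archLocal_diagonal L 3 α w _⟩ * g⁻¹ : archLocal L 3 (Matrix.diagonal α) w) : GL (Fin 3) ℂ) : Matrix (Fin 3) (Fin 3) ℂ) ∂ν) ψ)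
            (𝓝[≠] 0)
            (𝓝 (c₁ * ∫ y, descConj (⟨circleDiagonal 3 z₀, circleDiagonal_mem_archLocal_diagonal L 3 α w z₀⟩ : archLocal L 3 (Matrix.diagonal α) w)
              (Subgroup.centralizer ({(⟨circleDiagonal 3 z₁, circleDiagonal_mem_archLocal_diagonal L 3 α w z₁⟩ : archLocal L 3 (Matrix.diagonal α) w)} : Set (archLocal L 3 (Matrix.diagonal α) w)))
              (forall_mem_centralizer_circleDiagonal_comm_of_wall L α w h02 h01 h02' h01')
              (fun k : archLocal L 3 (Matrix.diagonal α) w => Θ ((k : GL (Fin 3) ℂ) : Matrix (Fin 3) (Fin 3) ℂ)) y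
              ∂(quotientMeasure _ νH (isClosed_coe_centralizer_singleton _) ν))))
    (h₂ : ∀ (Θ : Matrix (Fin 3) (Fin 3) ℂ → ℂ), ContDiff ℝ (⊤ : ℕ∞) Θ →
        HasCompactSupport (fun k : archLocal L 3 (Matrix.diagonal α) w => Θ ((k : GL (Fin 3) ℂ) : Matrix (Fin 3) (Fin 3) ℂ)) →
        ∀ (z₀ : Fin 3 → Circle) (h02' : z₀ 0 = z₀ 2) (h01' : z₀ 0 ≠ z₀ 1),
          Tendsto (fun ψ : ℝ => deriv (fun ψ : ℝ => (2 * Real.sin ψ : ℂ) *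
              ∫ g, Θ (((g * ⟨circleDiagonal 3 (fun i => z₀ i * Circle.exp (![(1 : ℝ), 0, -1] i * ψ)),
                circleDiagonal_mem_archLocal_diagonal L 3 α w _⟩ * g⁻¹ : archLocal L 3 (Matrix.diagonal α) w) : GL (Fin 3) ℂ) : Matrix (Fin 3) (Fin 3) ℂ) ∂ν) ψ)
            (𝓝[≠] 0)
            (𝓝 (c₂ * ∫ y, descConj (⟨circleDiagonal 3 z₀, circleDiagonal_mem_archLocal_diagonal L 3 α w z₀⟩ : archLocal L 3 (Matrix.diagonal α) w)
              (Subgroup.centralizer ({(⟨circleDiagonal 3 z₁, circleDiagonal_mem_archLocal_diagonal L 3 α w z₁⟩ : archLocal L 3 (Matrix.diagonal α) w)} : Set (archLocal L 3 (Matrix.diagonal α) w)))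
              (forall_mem_centralizer_circleDiagonal_comm_of_wall L α w h02 h01 h02' h01')
              (fun k : archLocal L 3 (Matrix.diagonal α) w => Θ ((k : GL (Fin 3) ℂ) : Matrix (Fin 3) (Fin 3) ℂ)) y
              ∂(quotientMeasure _ νH (isClosed_coe_centralizer_singleton _) ν)))) :
    c₁ = c₂ := by
  classical
  haveI : IsClosed ((Subgroup.centralizer ({(⟨circleDiagonal 3 z₁, circleDiagonal_mem_archLocal_diagonal L 3 α w z₁⟩ : archLocal L 3 (Matrix.diagonal α) w)} : Set (archLocal L 3 (Matrix.diagonal α) w))) : Set (archLocal L 3 (Matrix.diagonal α) w)) := isClosed_coe_centralizer_singleton _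
  have hherm : ∀ i, (IsCMField.complexConj L (α i) : L) = α i := fun i => by
    apply w.1.embedding.injective
    rw [NumberField.IsCMField.complexEmbedding_complexConj, Complex.conj_eq_iff_im, hreal i]
  haveI := Literature.MeasureTheory.Group.isOpenPosMeasure_quotientMeasure (Subgroup.centralizer ({(⟨circleDiagonal 3 z₁, circleDiagonal_mem_archLocal_diagonal L 3 α w z₁⟩ : archLocal L 3 (Matrix.diagonal α) w)} : Set (archLocal L 3 (Matrix.diagonal α) w))) (isClosed_coe_centralizer_singleton _) νH ν
  -- the test function: a smooth bump `χ` with `χ(↑↑(t z₁)) = 1`, `0 ≤ χ ≤ 1`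
  obtain ⟨χ, hχ, hχs, hχ1, hχ01⟩ := exists_contDiff_hasCompactSupport_eq_one_of_isCompact
    (isCompact_singleton (x := (((⟨circleDiagonal 3 z₁, circleDiagonal_mem_archLocal_diagonal L 3 α w z₁⟩ : archLocal L 3 (Matrix.diagonal α) w) : GL (Fin 3) ℂ) : Matrix (Fin 3) (Fin 3) ℂ)))
  have hΘ : ContDiff ℝ (⊤ : ℕ∞) (fun X : Matrix (Fin 3) (Fin 3) ℂ => (χ X : ℂ)) := Complex.ofRealCLM.contDiff.comp (hχ ⊤)
  have hcoe : Continuous fun k : archLocal L 3 (Matrix.diagonal α) w => ((k : GL (Fin 3) ℂ) : Matrix (Fin 3) (Fin 3) ℂ) := Units.continuous_val.comp continuous_subtype_val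
  have hΘs : HasCompactSupport (fun k : archLocal L 3 (Matrix.diagonal α) w => ((χ ((k : GL (Fin 3) ℂ) : Matrix (Fin 3) (Fin 3) ℂ) : ℝ) : ℂ)) := by
    refine IsCompact.of_isClosed_subset (isCompact_setOf_coe_archLocal_mem L 3 α w hα hχs.isCompact) (isClosed_tsupport _) ?_
    refine closure_minimal (fun k hk => ?_) ((isClosed_tsupport χ).preimage hcoe)
    refine subset_tsupport χ fun h0 => ?_
    rw [Function.mem_support] at hk
    exact hk (by simp only [h0, Complex.ofReal_zero])
  -- the two limits at `(Θ, z₁)` coincide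
  have heq := tendsto_nhds_unique (h₁ _ hΘ hΘs z₁ h02 h01) (h₂ _ hΘ hΘs z₁ h02 h01)
  -- the singular integral `I = ∫ descConj (t z₁) χ d(ν∕ν_H)` is positive
  have hcont : Continuous (descConj (⟨circleDiagonal 3 z₁, circleDiagonal_mem_archLocal_diagonal L 3 α w z₁⟩ : archLocal L 3 (Matrix.diagonal α) w)
      (Subgroup.centralizer ({(⟨circleDiagonal 3 z₁, circleDiagonal_mem_archLocal_diagonal L 3 α w z₁⟩ : archLocal L 3 (Matrix.diagonal α) w)} : Set (archLocal L 3 (Matrix.diagonal α) w))) (forall_mem_centralizer_circleDiagonal_comm_of_wall L α w h02 h01 h02 h01)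
      (fun k : archLocal L 3 (Matrix.diagonal α) w => χ ((k : GL (Fin 3) ℂ) : Matrix (Fin 3) (Fin 3) ℂ))) :=
    continuous_descConj _ _ _ ((hχ ⊤).continuous.comp hcoe)
  -- compact support on the quotient, by ★ (d1)
  obtain ⟨S, hS, hSmem⟩ := exists_isCompact_forall_mk_mem_of_conj_mem_wall L α w hα hherm h02 h01 (isCompact_singleton (x := z₁))
    (by intro z hz; rw [Set.mem_singleton_iff.mp hz]; exact ⟨fun h => h01 h.symm, fun h => h01 (h02.trans h.symm)⟩)
    (isCompact_setOf_coe_archLocal_mem L 3 α w hα hχs.isCompact)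
  have hsupp : HasCompactSupport (descConj (⟨circleDiagonal 3 z₁, circleDiagonal_mem_archLocal_diagonal L 3 α w z₁⟩ : archLocal L 3 (Matrix.diagonal α) w)
      (Subgroup.centralizer ({(⟨circleDiagonal 3 z₁, circleDiagonal_mem_archLocal_diagonal L 3 α w z₁⟩ : archLocal L 3 (Matrix.diagonal α) w)} : Set (archLocal L 3 (Matrix.diagonal α) w))) (forall_mem_centralizer_circleDiagonal_comm_of_wall L α w h02 h01 h02 h01)
      (fun k : archLocal L 3 (Matrix.diagonal α) w => χ ((k : GL (Fin 3) ℂ) : Matrix (Fin 3) (Fin 3) ℂ))) := by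
    refine IsCompact.of_isClosed_subset hS (isClosed_tsupport _) (closure_minimal (fun y hy => ?_) hS.isClosed)
    obtain ⟨g, rfl⟩ := QuotientGroup.mk_surjective y
    rw [Function.mem_support, descConj_mk] at hy
    exact hSmem g z₁ (Set.mem_singleton z₁) (subset_tsupport χ hy)
  have hnonneg : 0 ≤ descConj (⟨circleDiagonal 3 z₁, circleDiagonal_mem_archLocal_diagonal L 3 α w z₁⟩ : archLocal L 3 (Matrix.diagonal α) w)
      (Subgroup.centralizer ({(⟨circleDiagonal 3 z₁, circleDiagonal_mem_archLocal_diagonal L 3 α w z₁⟩ : archLocal L 3 (Matrix.diagonal α) w)} : Set (archLocal L 3 (Matrix.diagonal α) w))) (forall_mem_centralizer_circleDiagonal_comm_of_wall L α w h02 h01 h02 h01)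
      (fun k : archLocal L 3 (Matrix.diagonal α) w => χ ((k : GL (Fin 3) ℂ) : Matrix (Fin 3) (Fin 3) ℂ)) := fun y => by
    obtain ⟨g, rfl⟩ := QuotientGroup.mk_surjective y
    rw [descConj_mk]; exact (hχ01 _).1
  have hone : descConj (⟨circleDiagonal 3 z₁, circleDiagonal_mem_archLocal_diagonal L 3 α w z₁⟩ : archLocal L 3 (Matrix.diagonal α) w)
      (Subgroup.centralizer ({(⟨circleDiagonal 3 z₁, circleDiagonal_mem_archLocal_diagonal L 3 α w z₁⟩ : archLocal L 3 (Matrix.diagonal α) w)} : Set (archLocal L 3 (Matrix.diagonal α) w))) (forall_mem_centralizer_circleDiagonal_comm_of_wall L α w h02 h01 h02 h01)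
      (fun k : archLocal L 3 (Matrix.diagonal α) w => χ ((k : GL (Fin 3) ℂ) : Matrix (Fin 3) (Fin 3) ℂ)) (QuotientGroup.mk 1) ≠ 0 := by
    rw [descConj_mk, one_mul, inv_one, mul_one, hχ1 _ (Set.mem_singleton _)]; exact one_ne_zero
  have hI : 0 < ∫ y, descConj (⟨circleDiagonal 3 z₁, circleDiagonal_mem_archLocal_diagonal L 3 α w z₁⟩ : archLocal L 3 (Matrix.diagonal α) w)
      (Subgroup.centralizer ({(⟨circleDiagonal 3 z₁, circleDiagonal_mem_archLocal_diagonal L 3 α w z₁⟩ : archLocal L 3 (Matrix.diagonal α) w)} : Set (archLocal L 3 (Matrix.diagonal α) w))) (forall_mem_centralizer_circleDiagonal_comm_of_wall L α w h02 h01 h02 h01)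
      (fun k : archLocal L 3 (Matrix.diagonal α) w => χ ((k : GL (Fin 3) ℂ) : Matrix (Fin 3) (Fin 3) ℂ)) y ∂(quotientMeasure _ νH (isClosed_coe_centralizer_singleton _) ν) :=
    hcont.integral_pos_of_hasCompactSupport_nonneg_nonzero hsupp hnonneg hone
  -- the complex integral is the real one
  have hIC : ∫ y, descConj (⟨circleDiagonal 3 z₁, circleDiagonal_mem_archLocal_diagonal L 3 α w z₁⟩ : archLocal L 3 (Matrix.diagonal α) w)
      (Subgroup.centralizer ({(⟨circleDiagonal 3 z₁, circleDiagonal_mem_archLocal_diagonal L 3 α w z₁⟩ : archLocal L 3 (Matrix.diagonal α) w)} : Set (archLocal L 3 (Matrix.diagonal α) w))) (forall_mem_centralizer_circleDiagonal_comm_of_wall L α w h02 h01 h02 h01)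
      (fun k : archLocal L 3 (Matrix.diagonal α) w => ((χ ((k : GL (Fin 3) ℂ) : Matrix (Fin 3) (Fin 3) ℂ) : ℝ) : ℂ)) y ∂(quotientMeasure _ νH (isClosed_coe_centralizer_singleton _) ν) =
      ((∫ y, descConj (⟨circleDiagonal 3 z₁, circleDiagonal_mem_archLocal_diagonal L 3 α w z₁⟩ : archLocal L 3 (Matrix.diagonal α) w)
      (Subgroup.centralizer ({(⟨circleDiagonal 3 z₁, circleDiagonal_mem_archLocal_diagonal L 3 α w z₁⟩ : archLocal L 3 (Matrix.diagonal α) w)} : Set (archLocal L 3 (Matrix.diagonal α) w))) (forall_mem_centralizer_circleDiagonal_comm_of_wall L α w h02 h01 h02 h01)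
      (fun k : archLocal L 3 (Matrix.diagonal α) w => χ ((k : GL (Fin 3) ℂ) : Matrix (Fin 3) (Fin 3) ℂ)) y ∂(quotientMeasure _ νH (isClosed_coe_centralizer_singleton _) ν) : ℝ) : ℂ) := by
    rw [← integral_complex_ofReal]
    refine integral_congr_ae (Eventually.of_forall fun y => ?_)
    obtain ⟨g, rfl⟩ := QuotientGroup.mk_surjective y
    simp only [descConj_mk]
  rw [hIC] at heq
  exact mul_right_cancel₀ (Complex.ofReal_ne_zero.mpr hI.ne') heq

end Literature.NumberTheory.Rogawski1990

end
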